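/-
Copyright (c) 2026 the pub-hodgecm-mathlib formalisation cell (harness21).  Prover seat hodgecm-mathlib-K2Liu-p09 (g6): Track B «K2-LIT»,
hLiu418 = stmt-HodgeConjecture-24832; LEAD F0P6-plan RULING M-158d «A7-val road (σ)», instance layer I-0 (the real frame of ★ β-1's Δ-model and its Levi action).
-/
import Summits.HodgeConjecture.HodgeConjecture.Theorems.K2LiuDeltaSpTransportAdaptedBlocks   -- ★ A2d (master formula, Levi letter; brings `quadraticLocalEquiv`, `glue`, `matA`, `blkD`)
import HarnessLib

/-!
# Crux `HLiu418`, road `K2_Liu`, organ A7-val, instance layer I-0: THE REAL FRAME `R : (E ⊗ F_v)^n ≃ X_Δ = F_v^{n+n}` AND THE LEVI ACTION ON `X_Δ`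

Cell `hodgecm-mathlib`, crux item hLiu418 = `stmt-HodgeConjecture-24832`; squad K2 ∕ K2Liu; prover K2Liu-p09 (g6), organ lead A7-val.  DEFINITION LANE
(`--supports stmt-HodgeConjecture-24832 --as helper`): DEFINITIONS WITH BODIES + their API; no instance, no notation, no sorry.  Generic D10 currency
(`F, E, c, δ, v, n`), every finite place.  This is the dictionary the (σ) instance payers write against (K2E5-plan 12:32:27Z (2), LEAD BATCH #13 (4)): the
`X_Δ`-coordinates of ★ β-1's doubling-polarised model ARE `R b`, `b : Fin n → E ⊗ F_v` (★ A2d `exists_eq_glue_re_im`), and every block-diagonal `h ∈ U(𝔻)(F_v)`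
acts there by `b ↦ D(h) b` (★ A2d master formula `deltaTransport_iotaD_apply`).
* §1 **`reFrame`** — `R : (Fin n → LocalRing E v) ≃ₗ[F_v] (Fin (n + n) → F_v)`, `R b = glue e₂ (re ∘ b) (im ∘ b)` (★ `quadraticLocalEquiv` coordinates), with
  `reFrame_apply` (= the expression A2d's letters are written in), `reFrame_symm_apply`, surjectivity for free.
* §2 **`leviAct`** — the homomorphism `GL_n(E ⊗ F_v) →* GL_{F_v}(X_Δ)`, `D ↦ R ∘ (D *ᵥ ·) ∘ R⁻¹`, with `leviAct_apply_reFrame : leviAct D (R b) = R (D b)`; this is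
  the `aX`∕`ρ` currency of ★ V8c∕V8e (`aX a = leviAct (D(m(a)) ⊗ 1)`, `ρ g = leviAct (1 ⊗ g)` at the big datum, files I-1∕I-2).
* §3 **the bridge to ★ A2d's ∃-letter**: for block-diagonal `h` (`B = C = 0`), the Levi letter `a` of ★ `exists_deltaTransport_iotaD_eq_leviSp` IS
  `leviAct (D(h))`: `deltaCoords ∘ ι(h) ∘ deltaCoords⁻¹ = leviSp (leviAct D(h)) d` (`exists_deltaTransport_iotaD_eq_leviSp_leviAct`) — so ★ A2c
  `exists_character_toRep_eq_smul` applies with `ρ := leviAct ∘ D`.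
HONEST LABEL.  `HC_CM` is proved only modulo the 7 printed citations (2 remaining named inputs: hLiu418 = `stmt-HodgeConjecture-24832`,
h413 = `stmt-HodgeConjecture-24833`) until rung 0 closes.

## References
* [Kudla1994] S. Kudla, Israel J. Math. 87 (1994), §3 (the Siegel parabolic acts linearly in the Schrödinger model of its Lagrangian).
* [MoeglinVignerasWaldspurger1987] C. Mœglin, M.-F. Vignéras, J.-L. Waldspurger, LNM 1291, Chap. 2 I.7, II.6.
* [HarrisKudlaSweet1996] M. Harris, S. Kudla, W. J. Sweet, J. AMS 9 (1996), §1 (1.11).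
-/

set_option autoImplicit false
set_option linter.dupNamespace false -- the mandated namespace repeats `HodgeConjecture.HodgeConjecture`

noncomputable section

open Matrix Topology
open NumberField IsDedekindDomain
open Literature.NumberTheory.Automorphic Literature.NumberTheory.Automorphic.UnitaryGroup
open Literature.NumberTheory.Automorphic.UnitaryGroup.QuadraticCoordinates
open Literature.RepresentationTheory.HeisenbergGroup
open Literature.NumberTheory.GelbartRogawski1991 Literature.NumberTheory.GelbartRogawski1991.AdaptedBlocks
open Literature.NumberTheory.GelbartRogawski1991.UnitaryDualPair.LocalSplitting
open Summit.HodgeConjecture.HodgeConjecture.Cruxes.HLiu418.K2LiuDeltaSpTransportSiegelLetters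
open Summit.HodgeConjecture.HodgeConjecture.Cruxes.HLiu418.K2LiuDeltaSpTransportAdaptedBlocks

namespace Summit.HodgeConjecture.HodgeConjecture.Cruxes.HLiu418.K2LiuDeltaModelRealFrame

variable (F : Type) [Field F] [NumberField F] (E : Type) [Field E] [NumberField E] [Algebra F E]
  [Algebra.IsQuadraticExtension F E] (c : E ≃ₐ[F] E)
  {δ : E} (hcδ : c δ = -δ) (hδ : δ ≠ 0) (v : HeightOneSpectrum (𝓞 F)) (n : ℕ)

/-! ## §1 The real frame -/

omit [NumberField E] in
/-- scalars pass through `glue`. [folklore] -/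
theorem glue_smul {ι₁ ι₂ ι : Type*} (e : ι₁ ⊕ ι₂ ≃ ι) (t : v.adicCompletion F) (a : ι₁ → v.adicCompletion F) (b : ι₂ → v.adicCompletion F) :
    glue e (t • a) (t • b) = t • glue e a b := by
  funext k
  simp only [glue, Pi.smul_apply]
  cases e.symm k <;> rfl

/-- **THE REAL FRAME `R`** of the Δ-model: `R b := glue e₂ (re ∘ b) (im ∘ b)` — the `F_v`-linear isomorphism `(E ⊗ F_v)^n ≃ F_v^{n+n} = X_Δ` in which ★ A2d's
letters are written (`quadraticLocalEquiv` coordinates `x = re x + im x · δ`). [cite: Kudla1994, §3] [cite: MoeglinVignerasWaldspurger1987, Chap. 2 I.7] -/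
def reFrame : (Fin n → LocalRing E v) ≃ₗ[v.adicCompletion F] (Fin (n + n) → v.adicCompletion F) where
  toFun b := glue (e₂ n) (fun i => re (quadraticLocalEquiv E v c hcδ hδ).toLinearEquiv.toAddEquiv (b i))
    (fun i => im (quadraticLocalEquiv E v c hcδ hδ).toLinearEquiv.toAddEquiv (b i))
  invFun x i := quadraticLocalEquiv E v c hcδ hδ (resL (e₂ n) x i, resR (e₂ n) x i)
  map_add' b b' := by
    rw [glue_add]
    congr 1 <;> funext i <;> simp only [Pi.add_apply, map_add]
  map_smul' t b := by
    rw [RingHom.id_apply, ← glue_smul]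
    congr 1 <;> funext i
    · simp only [Pi.smul_apply, re_def]
      show ((quadraticLocalEquiv E v c hcδ hδ).symm (t • b i)).1 = t • ((quadraticLocalEquiv E v c hcδ hδ).symm (b i)).1
      rw [map_smul, Prod.smul_fst]
    · simp only [Pi.smul_apply, im_def]
      show ((quadraticLocalEquiv E v c hcδ hδ).symm (t • b i)).2 = t • ((quadraticLocalEquiv E v c hcδ hδ).symm (b i)).2
      rw [map_smul, Prod.smul_snd]
  left_inv b := by
    funext i
    simp only [resL_glue, resR_glue]
    exact apply_re_im (quadraticLocalEquiv E v c hcδ hδ).toLinearEquiv.toAddEquiv (b i)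
  right_inv x := by
    simp only []
    conv_rhs => rw [← glue_resL_resR (e₂ n) x]
    congr 1 <;> funext i
    · exact re_apply (quadraticLocalEquiv E v c hcδ hδ).toLinearEquiv.toAddEquiv _ _
    · exact im_apply (quadraticLocalEquiv E v c hcδ hδ).toLinearEquiv.toAddEquiv _ _

/-- unfolding: `R b = glue e₂ (re ∘ b) (im ∘ b)`. [cite: Kudla1994, §3] -/
theorem reFrame_apply (b : Fin n → LocalRing E v) :
    reFrame F E c hcδ hδ v n b = glue (e₂ n) (fun i => re (quadraticLocalEquiv E v c hcδ hδ).toLinearEquiv.toAddEquiv (b i))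
      (fun i => im (quadraticLocalEquiv E v c hcδ hδ).toLinearEquiv.toAddEquiv (b i)) :=
  rfl

/-- unfolding of the inverse: `(R⁻¹ x)_i = Ψ_v (x_L i, x_R i)`. [cite: Kudla1994, §3] -/
theorem reFrame_symm_apply (x : Fin (n + n) → v.adicCompletion F) (i : Fin n) :
    (reFrame F E c hcδ hδ v n).symm x i = quadraticLocalEquiv E v c hcδ hδ (resL (e₂ n) x i, resR (e₂ n) x i) :=
  rfl

/-! ## §2 The Levi action on `X_Δ` -/

/-- **THE LEVI ACTION `leviAct : GL_n(E ⊗ F_v) →* GL_{F_v}(X_Δ)`**, `D ↦ R ∘ (D *ᵥ ·) ∘ R⁻¹` — the linear action on the Δ-model's `X_Δ` of a block-diagonal element of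
`U(𝔻)(F_v)` with `D`-block `D` (§3), in particular of the Siegel Levi `m(a)` and of the partner group `1 ⊗ g` at the big datum (files I-1∕I-2); it is the `ρ`∕`aX`
currency of ★ V8c `value_eq_const_mul_of_laws`. [cite: Kudla1994, §3] [cite: MoeglinVignerasWaldspurger1987, Chap. 2 II.6] -/
def leviAct : GL (Fin n) (LocalRing E v) →* ((Fin (n + n) → v.adicCompletion F) ≃ₗ[v.adicCompletion F] (Fin (n + n) → v.adicCompletion F)) where
  toFun D :=
    { toFun := fun x => reFrame F E c hcδ hδ v n (D.val *ᵥ (reFrame F E c hcδ hδ v n).symm x)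
      invFun := fun x => reFrame F E c hcδ hδ v n ((D⁻¹).val *ᵥ (reFrame F E c hcδ hδ v n).symm x)
      map_add' := fun x y => by rw [map_add, Matrix.mulVec_add, map_add]
      map_smul' := fun t x => by rw [RingHom.id_apply, map_smul, Matrix.mulVec_smul, map_smul]
      left_inv := fun x => by
        simp only [LinearEquiv.symm_apply_apply, Matrix.mulVec_mulVec]
        rw [show (D⁻¹).val * D.val = 1 from by rw [← Units.val_mul, inv_mul_cancel, Units.val_one], Matrix.one_mulVec, LinearEquiv.apply_symm_apply]
      right_inv := fun x => by
        simp only [LinearEquiv.symm_apply_apply, Matrix.mulVec_mulVec]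
        rw [show D.val * (D⁻¹).val = 1 from by rw [← Units.val_mul, mul_inv_cancel, Units.val_one], Matrix.one_mulVec, LinearEquiv.apply_symm_apply] }
  map_one' := by
    apply LinearEquiv.ext; intro x
    show reFrame F E c hcδ hδ v n ((1 : GL (Fin n) (LocalRing E v)).val *ᵥ (reFrame F E c hcδ hδ v n).symm x) = x
    rw [Units.val_one, Matrix.one_mulVec, LinearEquiv.apply_symm_apply]
  map_mul' D D' := by
    apply LinearEquiv.ext; intro x
    show reFrame F E c hcδ hδ v n ((D * D').val *ᵥ (reFrame F E c hcδ hδ v n).symm x) =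
      reFrame F E c hcδ hδ v n (D.val *ᵥ (reFrame F E c hcδ hδ v n).symm (reFrame F E c hcδ hδ v n (D'.val *ᵥ (reFrame F E c hcδ hδ v n).symm x)))
    rw [LinearEquiv.symm_apply_apply, Matrix.mulVec_mulVec, Units.val_mul]

/-- unfolding: `leviAct D x = R (D *ᵥ R⁻¹ x)`. [cite: Kudla1994, §3] -/
theorem leviAct_apply (D : GL (Fin n) (LocalRing E v)) (x : Fin (n + n) → v.adicCompletion F) :
    leviAct F E c hcδ hδ v n D x = reFrame F E c hcδ hδ v n (D.val *ᵥ (reFrame F E c hcδ hδ v n).symm x) :=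
  rfl

/-- **`leviAct D (R b) = R (D b)`** — the action read on the real frame. [cite: Kudla1994, §3] -/
theorem leviAct_apply_reFrame (D : GL (Fin n) (LocalRing E v)) (b : Fin n → LocalRing E v) :
    leviAct F E c hcδ hδ v n D (reFrame F E c hcδ hδ v n b) = reFrame F E c hcδ hδ v n (D.val *ᵥ b) := by
  rw [leviAct_apply, LinearEquiv.symm_apply_apply]

/-- `leviAct D` is continuous (a linear map of the finite-dimensional `F_v^{n+n}`). [folklore] -/
theorem continuous_leviAct (D : GL (Fin n) (LocalRing E v)) : Continuous (leviAct F E c hcδ hδ v n D) :=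
  (leviAct F E c hcδ hδ v n D).toLinearMap.continuous_on_pi

/-- so is its inverse (`= leviAct D⁻¹`). [folklore] -/
theorem continuous_leviAct_symm (D : GL (Fin n) (LocalRing E v)) : Continuous (leviAct F E c hcδ hδ v n D).symm := by
  rw [show (leviAct F E c hcδ hδ v n D).symm = leviAct F E c hcδ hδ v n D⁻¹ by rw [map_inv]; rfl]
  exact continuous_leviAct F E c hcδ hδ v n D⁻¹

/-! ## §3 The `D`-block of a Siegel element as an element of `GL_n(E ⊗ F_v)`; the bridge to ★ A2d's Levi letter -/

section Bridge

variable {d : F} (hd : δ * δ = algebraMap F E d) {T₀ : Matrix (Fin n) (Fin n) F} (hT₀ : T₀.IsSymm) (hT₀d : IsUnit T₀.det)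
  {JD : Matrix (Fin (n + n)) (Fin (n + n)) E} (hJD : JD = (gramD F n T₀).map (algebraMap F E))

omit [Algebra.IsQuadraticExtension F E] in
/-- on `P_Δ = {C = 0}` the `D`-block has unit determinant (`det h = det A · det D`, ★ `det_eq_det_blkA_mul_det_blkD`, ★ `isUnit_det_matA`). [cite: Kudla1994, §3] -/
theorem isUnit_det_blkD (h : UnitaryGroup.localPi E c (n + n) JD v) (hC : blkC (matA F E c v n h) = 0) :
    IsUnit (blkD (matA F E c v n h)).det := by
  have hu := isUnit_det_matA F E c v n h
  rw [det_eq_det_blkA_mul_det_blkD hC] at hu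
  exact isUnit_of_mul_isUnit_right hu

/-- **THE `D`-BLOCK AS A UNIT**: `blkDGL h := ⟨D(h), …⟩ ∈ GL_n(E ⊗ F_v)` for `h ∈ P_Δ(F_v)` (`C(h) = 0`). [cite: Kudla1994, §3] [cite: HarrisKudlaSweet1996, §1 (1.11)] -/
def blkDGL (h : UnitaryGroup.localPi E c (n + n) JD v) (hC : blkC (matA F E c v n h) = 0) : GL (Fin n) (LocalRing E v) :=
  Matrix.GeneralLinearGroup.mk'' (blkD (matA F E c v n h)) (isUnit_det_blkD F E c v n h hC)

omit [Algebra.IsQuadraticExtension F E] in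
/-- unfolding: `(blkDGL h).val = D(h)`. [cite: Kudla1994, §3] -/
theorem val_blkDGL (h : UnitaryGroup.localPi E c (n + n) JD v) (hC : blkC (matA F E c v n h) = 0) :
    (blkDGL F E c v n h hC).val = blkD (matA F E c v n h) :=
  rfl

omit [Algebra.IsQuadraticExtension F E] in
/-- **`h ↦ D(h)` IS MULTIPLICATIVE ON `P_Δ`**: `D(g h) = D(g) D(h)` when `C(g) = 0` (★ `blkD_mul`). [cite: Kudla1994, §3] -/
theorem blkDGL_mul (g h : UnitaryGroup.localPi E c (n + n) JD v) (hCg : blkC (matA F E c v n g) = 0) (hCh : blkC (matA F E c v n h) = 0)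
    (hCgh : blkC (matA F E c v n (g * h)) = 0) :
    blkDGL F E c v n (g * h) hCgh = blkDGL F E c v n g hCg * blkDGL F E c v n h hCh := by
  apply Units.ext
  rw [Units.val_mul, val_blkDGL, val_blkDGL, val_blkDGL, ← matA_mul, blkD_mul, hCg, Matrix.zero_mul, zero_add]

include hd hT₀ hJD in
/-- **THE `D`-BLOCK HOMOMORPHISM ON THE SIEGEL PARABOLIC** `P →* GL_n(E ⊗ F_v)` for any subgroup `P` cut out by `IsSiegelDelta` (the GR pattern `(P) (hP)`).
[cite: Kudla1994, §3] [cite: HarrisKudlaSweet1996, §1 (1.11)] -/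
def blkDHom (P : Subgroup (UnitaryGroup.localPi E c (n + n) JD v)) (hP : ∀ h, h ∈ P ↔ IsSiegelDelta F E c hcδ hδ hd v n hT₀ hJD h) :
    P →* GL (Fin n) (LocalRing E v) where
  toFun p := blkDGL F E c v n (p : UnitaryGroup.localPi E c (n + n) JD v)
    ((isSiegelDelta_iff_blkC_eq_zero F E c hcδ hδ hd v n hT₀ hJD _).1 ((hP _).1 p.2))
  map_one' := by
    apply Units.ext
    rw [val_blkDGL, OneMemClass.coe_one, matA_one, blkD_one, Units.val_one]
  map_mul' p q := by
    rw [← blkDGL_mul]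
    rfl

include hd hT₀ hJD in
/-- unfolding: `(blkDHom P hP p).val = D(p)`. [cite: Kudla1994, §3] -/
theorem val_blkDHom (P : Subgroup (UnitaryGroup.localPi E c (n + n) JD v)) (hP : ∀ h, h ∈ P ↔ IsSiegelDelta F E c hcδ hδ hd v n hT₀ hJD h) (p : P) :
    (blkDHom F E c hcδ hδ v n hd hT₀ hJD P hP p).val = blkD (matA F E c v n (p : UnitaryGroup.localPi E c (n + n) JD v)) :=
  rfl

include hT₀ hT₀d hJD in
/-- **THE BRIDGE TO ★ A2d's LEVI LETTER**: for a block-DIAGONAL `h ∈ U(𝔻)(F_v)` (`B(h) = C(h) = 0`) and `D ∈ GL_n(E ⊗ F_v)` with `D = D(h)`,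
`deltaCoords ∘ ι(h) ∘ deltaCoords⁻¹ = leviSp (leviAct D) d` for some companion `d` — the ∃-letter `a` of ★ `exists_deltaTransport_iotaD_eq_leviSp` IS `leviAct D`
(both agree on the real frame, which is onto), so ★ A2c `exists_character_toRep_eq_smul` ∕ ★ A2d junction apply with `ρ := leviAct ∘ D`.
[cite: Kudla1994, §3] [cite: MoeglinVignerasWaldspurger1987, Chap. 2 II.6] -/
theorem exists_deltaTransport_iotaD_eq_leviSp_leviAct (h : UnitaryGroup.localPi E c (n + n) JD v)
    (hB : blkB (matA F E c v n h) = 0) (hC : blkC (matA F E c v n h) = 0) (D : GL (Fin n) (LocalRing E v)) (hDh : D.val = blkD (matA F E c v n h)) :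
    ∃ (d : (Fin (n + n) → v.adicCompletion F) ≃ₗ[v.adicCompletion F] (Fin (n + n) → v.adicCompletion F))
      (had : ∀ x y : Fin (n + n) → v.adicCompletion F,
        Matrix.toLinearMap₂' (v.adicCompletion F) (deltaGram (e₂ n) (T₀.map (algebraMap F (v.adicCompletion F)))) (leviAct F E c hcδ hδ v n D x) (d y) =
          Matrix.toLinearMap₂' (v.adicCompletion F) (deltaGram (e₂ n) (T₀.map (algebraMap F (v.adicCompletion F)))) x y),
      deltaSymplecticTransport (e₂ n) (T₀.map (algebraMap F (v.adicCompletion F))) (localGram_gramD F v n (T₀ := T₀))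
          (iotaD F E c hcδ hδ hd v n hT₀ hJD h) = leviSp _ (leviAct F E c hcδ hδ v n D) d had := by
  obtain ⟨a, d, had, heq, ha, -⟩ := exists_deltaTransport_iotaD_eq_leviSp F E c hcδ hδ hd v n hT₀ hT₀d hJD h hB hC
  have hae : a = leviAct F E c hcδ hδ v n D := by
    apply LinearEquiv.ext
    intro x
    obtain ⟨b, rfl⟩ := exists_eq_glue_re_im F E c hcδ hδ v n x
    rw [ha b, ← reFrame_apply, ← reFrame_apply, leviAct_apply_reFrame, hDh]
  subst hae
  exact ⟨d, had, heq⟩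

end Bridge

end Summit.HodgeConjecture.HodgeConjecture.Cruxes.HLiu418.K2LiuDeltaModelRealFrame

end
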